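import Summits.NavierStokesRegularity.NavierStokesRegularity.Theorems.ExtremiserTransienceNearExtremalTransienceExtremiserLiouvilleConstantSpeedSlideInequalityExplicit
import Summits.NavierStokesRegularity.NavierStokesRegularity.Theorems.ExtremiserTransienceNearExtremalTransienceExtremiserLiouvilleConstantSpeedSlideStretchingAxial
import HarnessLib

/-!
# Crux `ExtremiserTransience.NearExtremalTransience` (stmt-NavierStokesRegularity-21883), line `extremiser_liouville`,
# stub K1b — **(INEQ)₃: THE SLIDE INEQUALITY AS AN INEQUALITY BETWEEN LAYER-SUPPORTED FORMS** (record §14, R6a pointwise complete)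

`--supports stmt-NavierStokesRegularity-21883` (helper).  Author: prover seat `ns-el-k1b` (g9).

`slideInequality_explicit` (…SlideInequalityExplicit) has every variation explicit; its only term NOT supported on the layer
`supp g′ ⊆ [−T, T]` is the axial stretching density `g(x₂)·∂₂⟪ω,DVω⟫`.  `integral_stretchingDensity_slideGenerator`
(…SlideStretchingAxial) converts it by the axial rule into `−∫g′⟪ω,DVω⟫`.  Result `slideInequality_layer`:
```
  S·( ∫g′⟪ω,DVω⟫ − ∫g′·T_A − ∫g″·T_B ) ≤ κ⋆²M²·( ∫|Dω|²_F · (−a₁(φ_g))_explicit + ∫‖ω‖² · (ĉ₁)_explicit ),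
```
EVERY integrand now carries a factor `g′(x₂)`, `g″(x₂)` or `g‴(x₂)` (lives on the layer) and involves at most `D²V`.
This completes the POINTWISE evaluation R6a of the record in Lean.  NOT done here (record §14/§15): (i) the integrations by
parts (T1)/(T2)/(C) of record §2 that exhibit the coercive second-order form, together with the flux-invariance step (KIN)
for the terms pairing an undifferentiated `V_h`/`B` with ONE derivative (`g‴⟪∂₂ω,B⟫` in `ĉ₁`; they are linear, not
quadratic, in the derivative and are converted into `V₂`-terms by `∫H′(x₂−s)‖V‖² ≡ E₀`, as `slideEnstrophyLaw_jet` did for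
the `W′`-line); (ii) the absorption step R6b (far-field smallness `σ = sup_layer‖V‖ ≤ c₀κ⋆M`, weighted Gagliardo–Nirenberg,
`L ≥ C₀ℓ`, exponential layer profiles) ⇒ (DEC) ⇒ `windowEnergy_nonpos_of_expDecay` (p733230) ⇒ no residue jet.

WHAT THIS IS NOT: K1b is NOT proved; nothing here proves NS regularity. [folklore]
-/

noncomputable section

open Set Filter Topology MeasureTheory Metric Function InnerProductSpace
open scoped ENNReal NNReal Topology InnerProductSpace RealInnerProductSpace ContDiff
open Literature.Analysis.FluidPDE Literature.Analysis

namespace Summit.NavierStokesRegularity.NavierStokesRegularity.Theorems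

-- the problem directory repeats the summit name (`NavierStokesRegularity/NavierStokesRegularity`)
set_option linter.dupNamespace false

namespace ExtremiserLiouville

open DepletionLadder.KStar

variable {v : EuclideanSpace ℝ (Fin 3) → EuclideanSpace ℝ (Fin 3)} {c : EuclideanSpace ℝ (Fin 3)} {g : ℝ → ℝ}

/-- **(INEQ)₃ — the slide inequality between layer-supported explicit forms** (hypotheses of `slideInequality_explicit`).
[folklore] -/
theorem slideInequality_layer
    (hv : ContDiff ℝ ∞ v) (hdiv : VectorCalculus.IsDivFree v) {M B : ℝ} (hMpos : 0 < M)
    (hM : ∀ x, ‖v x‖ = M) (hB : ∀ x, ‖fderiv ℝ v x‖ ≤ B)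
    (h1 : ∫⁻ x, ‖iteratedFDeriv ℝ 1 v x‖ₑ ^ 2 < ⊤) (h2 : ∫⁻ x, ‖iteratedFDeriv ℝ 2 v x‖ₑ ^ 2 < ⊤)
    (hatt : |∫ x, ⟪curl v x, fderiv ℝ v x (curl v x)⟫| = (sInf {κ : ℝ | (∀ (v : EuclideanSpace ℝ (Fin 3) → EuclideanSpace ℝ (Fin 3)) (M B : ℝ), ContDiff ℝ (⊤ : ℕ∞) v → Literature.Analysis.FluidPDE.VectorCalculus.IsDivFree v → (∀ x, ‖v x‖ ≤ M) → (∀ x, ‖fderiv ℝ v x‖ ≤ B) → (∫⁻ x, ‖iteratedFDeriv ℝ 0 v x‖ₑ ^ 2 < ⊤) → (∫⁻ x, ‖iteratedFDeriv ℝ 1 v x‖ₑ ^ 2 < ⊤) → (∫⁻ x, ‖iteratedFDeriv ℝ 2 v x‖ₑ ^ 2 < ⊤) → |∫ x, ⟪Literature.Analysis.FluidPDE.curl v x, fderiv ℝ v x (Literature.Analysis.FluidPDE.curl v x)⟫_ℝ| ≤ κ * M * Real.sqrt (∫ x, ‖Literature.Analysis.FluidPDE.curl v x‖ ^ 2) *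 Real.sqrt (∫ x, Literature.Analysis.FluidPDE.frobeniusNormSq (fderiv ℝ (Literature.Analysis.FluidPDE.curl v) x)))}) * M * Real.sqrt (∫ x, ‖curl v x‖ ^ 2) * Real.sqrt (∫ x, frobeniusNormSq (fderiv ℝ (curl v) x)))
    (hc0 : c 0 = 0) (hc1 : c 1 = 0) (hcM : ‖c‖ = M)
    (hg : ContDiff ℝ ∞ g) {T K0 K1 K2 K3 : ℝ} (hT : 0 < T)
    (hK0 : ∀ s, |g s| ≤ K0) (hK1 : ∀ s, |deriv g s| ≤ K1) (hK2 : ∀ s, |deriv (deriv g) s| ≤ K2)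
    (hK3 : ∀ s, |deriv (deriv (deriv g)) s| ≤ K3)
    (hT1 : ∀ s, T ≤ |s| → deriv g s = 0) (hT2 : ∀ s, T ≤ |s| → deriv (deriv g) s = 0)
    (hT3 : ∀ s, T ≤ |s| → deriv (deriv (deriv g)) s = 0)
    (hg0 : ∀ s, 0 ≤ g s) (hγ0 : ∀ s, 0 ≤ deriv g s)
    (hslab : Integrable (fun x => {x : EuclideanSpace ℝ (Fin 3) | |x 2| ≤ T}.indicator (fun x => ‖v x - c‖ ^ 2) x) volume)
    {h₀ : ℝ} (hh₀ : 0 < h₀) (hfar : ∀ x : EuclideanSpace ℝ (Fin 3), |x 2| ≤ T + h₀ → ‖v x - c‖ ^ 2 ≤ 2 * M ^ 2) :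
    (∫ x, ⟪curl v x, fderiv ℝ v x (curl v x)⟫) *
        (-(-(∫ x, deriv g (x 2) * ⟪curl v x, fderiv ℝ v x (curl v x)⟫) +
          (∫ x, deriv g (x 2) *
          (⟪((-2 * fderiv ℝ v x (EuclideanSpace.single (2 : Fin 3) (1 : ℝ)) 1) • EuclideanSpace.single (0 : Fin 3) (1 : ℝ) + (2 * fderiv ℝ v x (EuclideanSpace.single (2 : Fin 3) (1 : ℝ)) 0) • EuclideanSpace.single (1 : Fin 3) (1 : ℝ) + (curl v x 2) • EuclideanSpace.single (2 : Fin 3) (1 : ℝ)), fderiv ℝ v x (curl v x)⟫ +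
            curl v x 2 * ⟪curl v x, fderiv ℝ v x (EuclideanSpace.single (2 : Fin 3) (1 : ℝ))⟫ +
            ⟪curl v x, fderiv ℝ v x (curl v x) - (fderiv ℝ v x (curl v x) 2) • EuclideanSpace.single (2 : Fin 3) (1 : ℝ)⟫ +
            ⟪curl v x, fderiv ℝ v x ((-2 * fderiv ℝ v x (EuclideanSpace.single (2 : Fin 3) (1 : ℝ)) 1) • EuclideanSpace.single (0 : Fin 3) (1 : ℝ) + (2 * fderiv ℝ v x (EuclideanSpace.single (2 : Fin 3) (1 : ℝ)) 0) • EuclideanSpace.single (1 : Fin 3) (1 : ℝ) + (curl v x 2) • EuclideanSpace.single (2 : Fin 3) (1 : ℝ))⟫)) +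
          ∫ x, deriv (deriv g) (x 2) *
          (⟪((-(v x - c) 1) • EuclideanSpace.single (0 : Fin 3) (1 : ℝ) + ((v x - c) 0) • EuclideanSpace.single (1 : Fin 3) (1 : ℝ)), fderiv ℝ v x (curl v x)⟫ +
            curl v x 2 * ⟪curl v x, v x - c - ((v x - c) 2) • EuclideanSpace.single (2 : Fin 3) (1 : ℝ)⟫ +
            ⟪curl v x, fderiv ℝ v x ((-(v x - c) 1) • EuclideanSpace.single (0 : Fin 3) (1 : ℝ) + ((v x - c) 0) • EuclideanSpace.single (1 : Fin 3) (1 : ℝ))⟫))) ≤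
      (sInf {κ : ℝ | (∀ (v : EuclideanSpace ℝ (Fin 3) → EuclideanSpace ℝ (Fin 3)) (M B : ℝ), ContDiff ℝ (⊤ : ℕ∞) v → Literature.Analysis.FluidPDE.VectorCalculus.IsDivFree v → (∀ x, ‖v x‖ ≤ M) → (∀ x, ‖fderiv ℝ v x‖ ≤ B) → (∫⁻ x, ‖iteratedFDeriv ℝ 0 v x‖ₑ ^ 2 < ⊤) → (∫⁻ x, ‖iteratedFDeriv ℝ 1 v x‖ₑ ^ 2 < ⊤) → (∫⁻ x, ‖iteratedFDeriv ℝ 2 v x‖ₑ ^ 2 < ⊤) → |∫ x, ⟪Literature.Analysis.FluidPDE.curl v x, fderiv ℝ v x (Literature.Analysis.FluidPDE.curl v x)⟫_ℝ| ≤ κ * M * Real.sqrt (∫ x, ‖Literature.Analysis.FluidPDE.curl v x‖ ^ 2) * Real.sqrt (∫ x, Literature.Analysis.FluidPDE.frobeniusNormSq (fderiv ℝ (Literature.Analysis.FluidPDE.curl v) x)))}) ^ 2 * M ^ 2 *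
        ((∫ x, frobeniusNormSq (fderiv ℝ (curl v) x)) *
          (-((∫ x, deriv g (x 2) *
          ((3 / 2) * (fderiv ℝ v x (EuclideanSpace.single 2 1) 0 ^ 2 + fderiv ℝ v x (EuclideanSpace.single 2 1) 1 ^ 2) +
            (1 / 2) * curl v x 2 ^ 2 -
            (1 / 2) * (fderiv ℝ v x (EuclideanSpace.single 0 1) 2 ^ 2 + fderiv ℝ v x (EuclideanSpace.single 1 1) 2 ^ 2) -
            (fderiv ℝ v x (EuclideanSpace.single 0 1) 2 * fderiv ℝ v x (EuclideanSpace.single 2 1) 0 +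
              fderiv ℝ v x (EuclideanSpace.single 1 1) 2 * fderiv ℝ v x (EuclideanSpace.single 2 1) 1))) +
        2 * (∫ x, deriv g (x 2) * (fderiv ℝ v x (EuclideanSpace.single (2 : Fin 3) (1 : ℝ)) 2) ^ 2) +
        2 * ∫ x, deriv g (x 2) *
          (fderiv ℝ v x (EuclideanSpace.single 0 1) 2 * fderiv ℝ v x (EuclideanSpace.single 2 1) 0 +
            fderiv ℝ v x (EuclideanSpace.single 1 1) 2 * fderiv ℝ v x (EuclideanSpace.single 2 1) 1))) +
          (∫ x, ‖curl v x‖ ^ 2) *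
          (-((1 / 2) * ∫ x, deriv g (x 2) * frobeniusNormSq (fderiv ℝ (curl v) x)) -
          (∫ x, deriv (deriv g) (x 2) * ⟪fderiv ℝ (curl v) x (EuclideanSpace.single (2 : Fin 3) (1 : ℝ)), curl v x⟫ +
        deriv g (x 2) * ‖fderiv ℝ (curl v) x (EuclideanSpace.single (2 : Fin 3) (1 : ℝ))‖ ^ 2 +
        deriv (deriv (deriv g)) (x 2) * ⟪fderiv ℝ (curl v) x (EuclideanSpace.single (2 : Fin 3) (1 : ℝ)),
          (-(v x - c) 1) • EuclideanSpace.single (0 : Fin 3) (1 : ℝ) + ((v x - c) 0) • EuclideanSpace.single (1 : Fin 3) (1 : ℝ)⟫ +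
        deriv (deriv g) (x 2) * ⟪fderiv ℝ (curl v) x (EuclideanSpace.single (2 : Fin 3) (1 : ℝ)),
          fderiv ℝ (fun z : EuclideanSpace ℝ (Fin 3) =>
            (-(v z - c) 1) • EuclideanSpace.single (0 : Fin 3) (1 : ℝ) + ((v z - c) 0) • EuclideanSpace.single (1 : Fin 3) (1 : ℝ)) x
            (EuclideanSpace.single (2 : Fin 3) (1 : ℝ))⟫ +
        ∑ i : Fin 3, (deriv (deriv g) (x 2) * ⟪fderiv ℝ (curl v) x (EuclideanSpace.basisFun (Fin 3) ℝ i),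
            fderiv ℝ (fun z : EuclideanSpace ℝ (Fin 3) =>
              (-(v z - c) 1) • EuclideanSpace.single (0 : Fin 3) (1 : ℝ) + ((v z - c) 0) • EuclideanSpace.single (1 : Fin 3) (1 : ℝ)) x
              (EuclideanSpace.basisFun (Fin 3) ℝ i)⟫ +
          deriv g (x 2) * ⟪fderiv ℝ (curl v) x (EuclideanSpace.basisFun (Fin 3) ℝ i),
            fderiv ℝ (fun y : EuclideanSpace ℝ (Fin 3) => fderiv ℝ (fun z : EuclideanSpace ℝ (Fin 3) =>
              (-(v z - c) 1) • EuclideanSpace.single (0 : Fin 3) (1 : ℝ) + ((v z - c) 0) • EuclideanSpace.single (1 : Fin 3) (1 : ℝ)) y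
              (EuclideanSpace.basisFun (Fin 3) ℝ i)) x (EuclideanSpace.single (2 : Fin 3) (1 : ℝ))⟫)) +
          ∫ x, deriv (deriv g) (x 2) * (fderiv ℝ (curl v) x (EuclideanSpace.single (2 : Fin 3) (1 : ℝ)) 0 * fderiv ℝ v x (EuclideanSpace.single (1 : Fin 3) (1 : ℝ)) 2 -
          fderiv ℝ (curl v) x (EuclideanSpace.single (2 : Fin 3) (1 : ℝ)) 1 * fderiv ℝ v x (EuclideanSpace.single (0 : Fin 3) (1 : ℝ)) 2) +
        deriv g (x 2) * ∑ i : Fin 3, (fderiv ℝ (curl v) x (EuclideanSpace.basisFun (Fin 3) ℝ i) 0 *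
            fderiv ℝ (fun y => fderiv ℝ v y (EuclideanSpace.single (1 : Fin 3) (1 : ℝ))) x (EuclideanSpace.basisFun (Fin 3) ℝ i) 2 -
          fderiv ℝ (curl v) x (EuclideanSpace.basisFun (Fin 3) ℝ i) 1 *
            fderiv ℝ (fun y => fderiv ℝ v y (EuclideanSpace.single (0 : Fin 3) (1 : ℝ))) x (EuclideanSpace.basisFun (Fin 3) ℝ i) 2))) := by
  have h := slideInequality_explicit hv hdiv hMpos hM hB h1 h2 hatt hc0 hc1 hcM hg hT hK0 hK1 hK2 hK3 hT1 hT2 hT3 hg0 hγ0 hslab hh₀ hfar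
  have hVs : ContDiff ℝ ∞ (fun y => v y - c) := hv.sub contDiff_const
  have hVk : ∀ k : ℕ, k ≠ 0 → (∫⁻ x, ‖iteratedFDeriv ℝ k v x‖ₑ ^ 2 < ⊤) →
      ∫⁻ x, ‖iteratedFDeriv ℝ k (fun y => v y - c) x‖ₑ ^ 2 < ⊤ := by
    intro k hk hkv
    have e : (fun x => ‖iteratedFDeriv ℝ k (fun y => v y - c) x‖ₑ ^ 2) = fun x => ‖iteratedFDeriv ℝ k v x‖ₑ ^ 2 := by
      funext x; rw [iteratedFDeriv_sub_const_of_ne hv c hk]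
    rw [e]; exact hkv
  have hB' : ∀ x, ‖fderiv ℝ (fun y => v y - c) x‖ ≤ B := fun x => by rw [fderiv_sub_const]; exact hB x
  have hT2' : ∀ s, T < |s| → deriv (deriv g) s = 0 := fun s hs => hT2 s hs.le
  have hcurl : curl (fun y => v y - c) = curl v := curl_sub_const v c
  have hS := integral_stretchingDensity_slideGenerator (V := fun y => v y - c) hVs hg hB' hK0 hK1 hK2 hT2'
    (hVk 1 one_ne_zero h1) (hVk 2 two_ne_zero h2) hslab
  simp only [hcurl, fderiv_sub_const] at hS
  rw [hS] at h
  exact h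

end ExtremiserLiouville

end Summit.NavierStokesRegularity.NavierStokesRegularity.Theorems

end
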